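import Mathlib
import HarnessLib
import Summits.Langlands.Langlands.Theorems.TwistUnpackaging.Negative.DetRescueBoundary

/-!
# `TwistUnpackaging` (stmt-Langlands-10903) — Negative knowledge VI: classification of the determinant rescue

`detRescue_iff : DetRescue n ↔ n ≤ 3` — the Berger–Harcos §6 / Mok Prop. 5.13 device for the
cofinite step (the `ψ = 1` identity, ONE quadratic-ratio identity, and the determinants, i.e. the
central character) pins the Frobenius data EXACTLY in ranks `0, 1, 2, 3`: ranks `0, 1` trivially,
rank `2` = `rank_two_det_rescue` (Negative II, the printed case), rank `3` = `det_rescue_rank_three`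
(Negative V), ranks `≥ 4` fail (`not_detRescue_of_four_le`, Negative V; pure witnesses too). For the
crux (general `n`) this closes the question "can quadratic twists plus a determinant datum replace
twists of ratio order `> n`?": yes iff `n ≤ 3`. From the standing disprover's `Disproof.lean`
(cdisprove gen 3, cycle 3). Mathlib-only. [folklore]
-/

namespace Summit.Langlands.Langlands.Theorems.TwistUnpackaging.Negative

open Multiset

/-- Rank `0`: nothing to pin. [folklore] -/
theorem detRescue_zero : DetRescue 0 := fun X _ S _ hX _ hS _ _ _ _ _ _ _ => by
  rw [Multiset.card_eq_zero.1 hX, Multiset.card_eq_zero.1 hS]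

/-- Rank `1`: the determinant IS the datum. [folklore] -/
theorem detRescue_one : DetRescue 1 := fun X _ S _ hX _ hS _ _ _ _ _ hdet _ => by
  obtain ⟨x, rfl⟩ := Multiset.card_eq_one.1 hX
  obtain ⟨s, rfl⟩ := Multiset.card_eq_one.1 hS
  simp only [Multiset.prod_singleton] at hdet
  rw [hdet]

/-- Rank `2`: Berger–Harcos' printed case, `rank_two_det_rescue` (Negative II) in `DetRescue`
clothing. [cite: BergerHarcos2007, §6] -/
theorem detRescue_two : DetRescue 2 := fun X X' S S' hX hX' hS hS' _ _ h1 h2 hdet _ => by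
  obtain ⟨a, b, rfl⟩ := Multiset.card_eq_two.1 hX
  obtain ⟨a', b', rfl⟩ := Multiset.card_eq_two.1 hX'
  obtain ⟨c, d, rfl⟩ := Multiset.card_eq_two.1 hS
  obtain ⟨c', d', rfl⟩ := Multiset.card_eq_two.1 hS'
  have h2' : ({a, b} : Multiset ℂ) + {-a', -b'} = {c, d} + {-c', -d'} := by
    simpa using h2
  have hdet' : a * b = c * d := by simpa using hdet
  exact rank_two_det_rescue a b a' b' c d c' d' h1 h2' hdet'

/-- **Classification.** `DetRescue n ↔ n ≤ 3`. [folklore] -/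
theorem detRescue_iff {n : ℕ} : DetRescue n ↔ n ≤ 3 := by
  refine ⟨fun h => ?_, fun h => ?_⟩
  · by_contra hn
    exact not_detRescue_of_four_le (by omega) h
  · interval_cases n
    exacts [detRescue_zero, detRescue_one, detRescue_two, detRescue_three]

end Summit.Langlands.Langlands.Theorems.TwistUnpackaging.Negative
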